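import Mathlib.Analysis.Complex.Polynomial.Basic
import Mathlib.Algebra.Polynomial.Roots
import Mathlib.Algebra.Polynomial.Splits
import Mathlib.FieldTheory.IsAlgClosed.Basic
import Mathlib.LinearAlgebra.Basis.VectorSpace
import Mathlib.LinearAlgebra.Matrix.ToLin
import Mathlib.LinearAlgebra.Matrix.NonsingularInverse
import Mathlib.Algebra.Order.Antidiag.Finsupp
import Mathlib.Algebra.MvPolynomial.PDeriv
import Literature.Computability.AlgebraicComplexity.BorderDcQuadraticBound
import Literature.Computability.AlgebraicComplexity.HessianRank
import Literature.Computability.AlgebraicComplexity.MignonRessayreBound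
import Literature.Computability.AlgebraicComplexity.OrbitClosureProofs
import HarnessLib

/-!
# The Landsberg–Manivel–Ressayre bound `\overline{dc}(perm_m) ≥ m²/2`: proof

Sibling proofs file of `Literature/Computability/AlgebraicComplexity/BorderDcQuadraticBound.lean`:
`LMR2013_thm_1_1_1_holds` DISCHARGES the named fact `LMR2013_thm_1_1_1` — for `m ≤ n`, if the
padded permanent `X₀₀^{n-m} per_m` lies in the orbit closure `Δ[det_n] = \overline{GL_{n²} · det_n}`
(over `ℂ`), then `m² ≤ 2n` (J. M. Landsberg, L. Manivel, N. Ressayre, *Hypersurfaces with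
degenerate duals and the Geometric Complexity Theory Program*, Comment. Math. Helv. 88 (2013)
469–484, Theorem 1.1.1; read on the materialised journal text, pp. 470–475).

## The printed proof and the proof formalised here

Printed architecture (LMR 2013): §2.1, B. Segre's formula `dim Z(P)^∨ = rank H_P(w) - 2` at a
general point `w` of the cone over `Z(P)`, so "`dim Z(P)^∨ ≤ k` iff `det (H_P|_F)(w) = 0` for all
`w ∈ Z(P)` and all `(k+3)`-planes `F`, i.e. (for `P` irreducible) `P` divides `det (H_P|_F)`";
§2.2–2.3, the divisibility "`P | Q`" is turned into POLYNOMIAL equations in the coefficients by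
restricting `P, Q` to planes `L` and expressing by Euclidean division that `P_L` divides `Q_L`
(Theorem 2.3.1: equations of `Dual_{k,d,N}`); §3.1, the dual of `{det_n = 0}` is the Segre variety
of rank-one matrices, of dimension `2n - 2`, so `[det_n] ∈ Dual_{2n-2,n,n²}`, a closed
`GL`-stable set, whence `\overline{GL · [det_n]} ⊆ Dual_{2n-2,n,n²}`; Lemma 2.4.1, padding
`P = ℓ^{n-m} R` does not change the dimension of the dual; and [3] = Mignon–Ressayre 2004, the
Hessian of `perm_m` is non-degenerate at a point of `{perm_m = 0}`, so `dim Z(perm_m)^∨ = m² - 2`;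
hence `m² - 2 ≤ 2n - 2`.

The tree has no dual varieties and no dimension theory, but it has all the INPUTS of this argument
in Hessian form (`HessianRank.lean`: the Hessian of a determinant of affine forms has rank `≤ 2n`
at every zero — the elementary content of "`dim {det_n = 0}^∨ = 2n - 2`" via Segre's formula;
`MignonRessayreBound.lean`: the Hessian of `per_{m}` at the Mignon–Ressayre point `y₀` is
`(m-3)! · mrHess`, invertible). We therefore run LMR's argument one dimension down and without the
word "dual variety", as follows (all statements below are proved in this file).

* (§2.1 ↦ `hessGenMinor`) For `r × N` scalar matrices `U, V` the *generalised minor*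
  `det (U · Hess P · Vᵀ)` is a polynomial; `rank Hess P (w) ≤ r - 1` kills all of them at `w`
  (`det_mul_mul_transpose_eq_zero_of_rank_le`). (LMR take `U = V` = a basis of `F`.)
* (§2.2 ↦ `lineRestr`, `lmrFamily`, `lmrInvariant`) Instead of planes we restrict to parametrised
  LINES `t ↦ x + t w` (`lineRestr`), and instead of the Euclidean-division remainder we express
  "`P|_L` divides `(Q|_L)^d`" (the `d`-th power absorbs multiplicities, so irreducibility of `P` is
  not needed) as the LINEAR DEPENDENCE of the univariate family `P|_L, t P|_L, …, t^{D₁} P|_L,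
  (Q|_L)^d` (`lmrFamily`), i.e. the vanishing of `det (lmrFamilyMatrix · Lᵀ)` for every test matrix `L`
  (`lmrInvariant`). This is visibly a polynomial in the coefficients of `P`: it is the
  specialisation of the same construction on the GENERIC form (`genericForm`,
  `map_lmrInvariant`), so it passes from `GL · det_n` to the Zariski closure `Δ[det_n]`
  (`transfer_orbitClosure`, `lmrInvariant_eq_zero_of_mem_orbitClosure`) — the rôle of
  Theorem 2.3.1.
* (§3.1 ↦ `lmrInvariant_eq_zero_of_mem_glOrbit_detPoly`) On `GL · det_n` every element is a
  determinant of linear forms; at every root `t₀` of `P|_L` the Hessian has rank `≤ 2n`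
  (`rank_hessianMatrix_le_two_mul_of_isAffineDetRepr`), so every generalised `(2n+1)`-minor
  vanishes there; over `ℂ` (algebraically closed) `P|_L` splits with multiplicities `≤ n`, hence
  `P|_L ∣ (Q|_L)^n` (`dvd_pow_of_roots`) and the family is dependent
  (`lmrInvariant_eq_zero_of_eq_mul`).
* (Lemma 2.4.1 + [3] ↦ `exists_lmrInvariant_eq_one_paddedPerPoly`) For the padded permanent with
  `2n + 1 ≤ m²`: at the point `x₀` (Mignon–Ressayre point on the block, `1` elsewhere, in
  particular `X₀₀ = 1`) the block of the Hessian is `(m-3)! · mrHess` (the padding factor is `1`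
  on the block directions, exactly the block form of the proof of Lemma 2.4.1), which is
  invertible, so `U = P S⁻¹ E`, `V = P E` give a generalised `(2n+1)`-minor equal to `1` at `x₀`;
  along the direction of the `(0,0)` block entry the padded permanent is `(m-1)! · t`
  (`eval_onesExcept_perPoly`), non-zero with a root at `t = 0`. So the family is linearly
  INDEPENDENT and some test matrix gives invariant `1` (`exists_lmrInvariant_eq_one`).
* Assembly (`LMR2013_thm_1_1_1_holds`): `2n < m²` and `m ≤ n` force `m ≥ 3`; contradiction.

## References

* [LandsbergManivelRessayre2013] J. M. Landsberg, L. Manivel, N. Ressayre, Comment. Math. Helv. 88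
  (2013) 469–484, doi:10.4171/cmh/292 — Thm. 1.1.1 (p. 470), §2.1 (Segre's formula, p. 472–473),
  §§2.2–2.3 (equations via restriction and division, Thm. 2.3.1), Lemma 2.4.1 (padding), §3.1.
* [MignonRessayre2004] T. Mignon, N. Ressayre, Int. Math. Res. Not. 2004:79, 4241–4253, §§2–3
  (rank of the Hessian of `det` at a singular matrix; the point `y₀`).
* [MulmuleySohoniSIAM2001] K. Mulmuley, M. Sohoni, SIAM J. Comput. 31 (2001), §4 (orbit closures,
  test polynomials on the space of forms).

## Design notes

* Everything generic (`lineRestr`, `hessPoly`, `hessGenMinor`, `lmrFamily`, `lmrFamilyMatrix`, `lmrInvariant`)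
  is defined over an arbitrary commutative ring and shown to commute with base change
  (`map_lineRestr`, `map_hessGenMinor`, `map_lmrInvariant`); polynomiality in the coefficients is then
  the single lemma `map_eval_coeffVec_genericForm` (specialising the generic degree-`d` form to the
  coefficient vector of a degree-`d` form gives the form back).
* Sizes: `d = n`, `r = 2n + 1`, `D₁ = n · ((2n+1) · n)` (a bound for `deg (Q|_L)^n`, from
  `totalDegree_hessGenMinor_le` and `natDegree_lineRestr_le`), `D₂ = D₁ + n`; the family is indexed by
  `Option (Fin (D₁ + 1))` (`none` = the power of the minor).
* What is NOT here: dual varieties, Theorem 1.2.1 for general irreducible `P`, Theorems 1.1.2 /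
  2.3.1 / 3.1.1 (modules of equations, irreducible components), Prop. 3.5.1.
-/

noncomputable section

open MvPolynomial Matrix

namespace Literature.Computability.AlgebraicComplexity

/-! ### Restriction of a polynomial to a parametrised line -/

section Line

variable {A : Type*} [CommRing A] {ι : Type*}

/-- The restriction of a polynomial `f` to the parametrised line `t ↦ x + t w`, as a univariate
polynomial in `t`: `X i ↦ x i + w i · t`. [folklore] -/
def lineRestr (x w : ι → A) : MvPolynomial ι A →ₐ[A] Polynomial A :=
  aeval fun i => Polynomial.C (x i) + Polynomial.C (w i) * Polynomial.X

/-- The restriction to a line on a variable. [folklore] -/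
theorem lineRestr_X (x w : ι → A) (i : ι) :
    lineRestr x w (X i) = Polynomial.C (x i) + Polynomial.C (w i) * Polynomial.X :=
  aeval_X _ _

/-- Values of the restriction: `(f|_{x + t w})(t) = f(x + t w)`. [folklore] -/
theorem eval_lineRestr (x w : ι → A) (f : MvPolynomial ι A) (t : A) :
    (lineRestr x w f).eval t = MvPolynomial.eval (x + t • w) f := by
  unfold lineRestr
  rw [← Polynomial.coe_evalRingHom, map_aeval]
  have hC : (Polynomial.evalRingHom t).comp (algebraMap A (Polynomial A)) = RingHom.id A := by
    ext a
    simp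
  have hfun : (fun i => Polynomial.evalRingHom t
      (Polynomial.C (x i) + Polynomial.C (w i) * Polynomial.X)) = x + t • w := by
    funext i
    simp only [Polynomial.coe_evalRingHom, Polynomial.eval_add, Polynomial.eval_C,
      Polynomial.eval_mul, Polynomial.eval_X, Pi.add_apply, Pi.smul_apply, smul_eq_mul]
    ring
  rw [hC, hfun]
  rfl

/-- The restriction to a line commutes with base change. [folklore] -/
theorem map_lineRestr {B : Type*} [CommRing B] (φ : A →+* B) (x w : ι → A)
    (f : MvPolynomial ι A) :
    (lineRestr x w f).map φ = lineRestr (φ ∘ x) (φ ∘ w) (MvPolynomial.map φ f) := by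
  unfold lineRestr
  rw [← Polynomial.coe_mapRingHom, map_aeval]
  change _ = aeval _ (MvPolynomial.map φ f)
  rw [MvPolynomial.aeval_def, MvPolynomial.eval₂_map]
  have h1 : (Polynomial.mapRingHom φ).comp (algebraMap A (Polynomial A)) =
      (algebraMap B (Polynomial B)).comp φ := RingHom.ext fun a => by simp
  have h2 : (fun i => Polynomial.mapRingHom φ
      (Polynomial.C (x i) + Polynomial.C (w i) * Polynomial.X)) =
      fun i => Polynomial.C ((⇑φ ∘ x) i) + Polynomial.C ((⇑φ ∘ w) i) * Polynomial.X := by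
    funext i
    simp
  rw [h1, h2]
  rfl

/-- The degree in `t` of the restriction of `f` to a line is at most the total degree of `f`.
[folklore] -/
theorem natDegree_lineRestr_le (x w : ι → A) (f : MvPolynomial ι A) :
    (lineRestr x w f).natDegree ≤ f.totalDegree := by
  classical
  rw [lineRestr, MvPolynomial.aeval_def, MvPolynomial.eval₂_eq]
  refine Polynomial.natDegree_sum_le_of_forall_le _ _ fun m hm => ?_
  refine (Polynomial.natDegree_mul_le).trans ?_
  have h1 : (algebraMap A (Polynomial A) (coeff m f)).natDegree = 0 := Polynomial.natDegree_C _
  rw [h1, zero_add]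
  refine (Polynomial.natDegree_prod_le _ _).trans ?_
  refine le_trans ?_ (le_totalDegree hm)
  rw [Finsupp.sum]
  refine Finset.sum_le_sum fun i _ => ?_
  refine (Polynomial.natDegree_pow_le).trans ?_
  have h2 : (Polynomial.C (x i) + Polynomial.C (w i) * Polynomial.X).natDegree ≤ 1 := by
    refine (Polynomial.natDegree_add_le _ _).trans (max_le ?_ ?_)
    · simp
    · exact (Polynomial.natDegree_C_mul_le _ _).trans Polynomial.natDegree_X_le
  simpa using Nat.mul_le_mul_left (m i) h2

end Line

/-! ### The polynomial Hessian matrix and its generalised minors -/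

section HessPoly

variable {A : Type*} [CommRing A] {ι : Type*}

/-- The Hessian matrix of `f` with polynomial entries `∂ᵢ ∂ⱼ f`. [folklore] -/
def hessPoly (f : MvPolynomial ι A) : Matrix ι ι (MvPolynomial ι A) :=
  Matrix.of fun i j => pderiv i (pderiv j f)

/-- Entries of the polynomial Hessian. [folklore] -/
theorem hessPoly_apply (f : MvPolynomial ι A) (i j : ι) :
    hessPoly f i j = pderiv i (pderiv j f) := rfl

/-- Evaluating the polynomial Hessian gives the Hessian matrix at the point. [folklore] -/
theorem hessPoly_map_eval (f : MvPolynomial ι A) (y : ι → A) :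
    (hessPoly f).map (MvPolynomial.eval y) = hessianMatrix f y := by
  ext i j
  rfl

/-- The polynomial Hessian commutes with base change. [folklore] -/
theorem hessPoly_map_map {B : Type*} [CommRing B] (φ : A →+* B) (f : MvPolynomial ι A) :
    (hessPoly f).map (MvPolynomial.map φ) = hessPoly (MvPolynomial.map φ f) := by
  ext i j
  simp only [Matrix.map_apply, hessPoly_apply, pderiv_map]

/-- Partial derivatives do not raise the total degree. [folklore] -/
theorem totalDegree_pderiv_le (i : ι) (f : MvPolynomial ι A) :
    (pderiv i f).totalDegree ≤ f.totalDegree := by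
  classical
  refine Finset.sup_le fun m hm => ?_
  rw [mem_support_iff, coeff_pderiv] at hm
  have hm' : m + Finsupp.single i 1 ∈ f.support := by
    rw [mem_support_iff]
    intro h
    exact hm (by rw [h, zero_mul])
  refine le_trans ?_ (le_totalDegree hm')
  change Finsupp.degree m ≤ Finsupp.degree (m + Finsupp.single i 1)
  rw [map_add]
  exact Nat.le_add_right _ _

variable [Fintype ι] {r : ℕ}

/-- The *generalised minor* `det (U · Hess f · Vᵀ)` of the polynomial Hessian, for `r × ι`
scalar matrices `U`, `V` (for `U = V` the matrix of a basis of an `r`-dimensional subspace `F`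
this is `det (H_f|_F)` of Landsberg–Manivel–Ressayre 2013, §2.1). [cite: LandsbergManivelRessayre2013, §2.1] -/
def hessGenMinor (U V : Matrix (Fin r) ι A) (f : MvPolynomial ι A) : MvPolynomial ι A :=
  (U.map (MvPolynomial.C : A →+* MvPolynomial ι A) * hessPoly f *
    (V.map (MvPolynomial.C : A →+* MvPolynomial ι A))ᵀ).det

/-- Values of the generalised minor: `det (U · Hess f (y) · Vᵀ)`. [folklore] -/
theorem eval_hessGenMinor (U V : Matrix (Fin r) ι A) (f : MvPolynomial ι A) (y : ι → A) :
    MvPolynomial.eval y (hessGenMinor U V f) = (U * hessianMatrix f y * Vᵀ).det := by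
  have hU : (U.map (MvPolynomial.C : A →+* MvPolynomial ι A)).map (MvPolynomial.eval y) = U :=
    Matrix.ext fun a b => by simp
  have hV : ((V.map (MvPolynomial.C : A →+* MvPolynomial ι A))ᵀ).map (MvPolynomial.eval y) = Vᵀ :=
    Matrix.ext fun a b => by simp
  rw [hessGenMinor, RingHom.map_det, RingHom.mapMatrix_apply, Matrix.map_mul, Matrix.map_mul,
    hessPoly_map_eval, hU, hV]

/-- The generalised minor commutes with base change. [folklore] -/
theorem map_hessGenMinor {B : Type*} [CommRing B] (φ : A →+* B) (U V : Matrix (Fin r) ι A)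
    (f : MvPolynomial ι A) :
    MvPolynomial.map φ (hessGenMinor U V f) =
      hessGenMinor (U.map φ) (V.map φ) (MvPolynomial.map φ f) := by
  have hU : (U.map (MvPolynomial.C : A →+* MvPolynomial ι A)).map (MvPolynomial.map φ) =
      (U.map φ).map (MvPolynomial.C : B →+* MvPolynomial ι B) :=
    Matrix.ext fun a b => by simp [map_C]
  have hV : ((V.map (MvPolynomial.C : A →+* MvPolynomial ι A))ᵀ).map (MvPolynomial.map φ) =
      ((V.map φ).map (MvPolynomial.C : B →+* MvPolynomial ι B))ᵀ :=
    Matrix.ext fun a b => by simp [map_C]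
  rw [hessGenMinor, RingHom.map_det, RingHom.mapMatrix_apply, Matrix.map_mul, Matrix.map_mul,
    hessPoly_map_map, hU, hV, hessGenMinor]

/-- Degree bound: `det (U · Hess f · Vᵀ)` has total degree `≤ r · deg f`. [folklore] -/
theorem totalDegree_hessGenMinor_le (U V : Matrix (Fin r) ι A) (f : MvPolynomial ι A) :
    (hessGenMinor U V f).totalDegree ≤ r * f.totalDegree := by
  classical
  have hentry : ∀ a b, ((U.map (MvPolynomial.C : A →+* MvPolynomial ι A) * hessPoly f *
      (V.map (MvPolynomial.C : A →+* MvPolynomial ι A))ᵀ) a b).totalDegree ≤ f.totalDegree := by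
    intro a b
    rw [Matrix.mul_apply]
    refine totalDegree_finsetSum_le fun j _ => ?_
    refine (totalDegree_mul _ _).trans ?_
    rw [Matrix.transpose_apply, Matrix.map_apply, totalDegree_C, add_zero, Matrix.mul_apply]
    refine totalDegree_finsetSum_le fun i _ => ?_
    refine (totalDegree_mul _ _).trans ?_
    rw [Matrix.map_apply, totalDegree_C, zero_add, hessPoly_apply]
    exact (totalDegree_pderiv_le _ _).trans (totalDegree_pderiv_le _ _)
  rw [hessGenMinor, Matrix.det_apply]
  refine totalDegree_finsetSum_le fun σ _ => ?_
  rw [Units.smul_def, zsmul_eq_mul, ← map_intCast (MvPolynomial.C : A →+* MvPolynomial ι A)]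
  refine (totalDegree_mul _ _).trans ?_
  rw [totalDegree_C, zero_add]
  refine (totalDegree_finsetProd _ _).trans ?_
  refine (Finset.sum_le_sum fun a _ => hentry (σ a) a).trans ?_
  simp

end HessPoly

/-! ### The univariate family and the invariant -/

section Family

variable {A : Type*} [CommRing A] {ι : Type*} [Fintype ι] {r : ℕ}

/-- The univariate family attached to a form `f`, a line `x + t w` and matrices `U, V`:
`t^j · f|_L` for `j ≤ D₁`, and `(det (U · Hess f · Vᵀ)|_L) ^ d`. [folklore] -/
def lmrFamily (d D₁ : ℕ) (x w : ι → A) (U V : Matrix (Fin r) ι A) (f : MvPolynomial ι A) :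
    Option (Fin (D₁ + 1)) → Polynomial A
  | none => lineRestr x w (hessGenMinor U V f) ^ d
  | some j => Polynomial.X ^ (j : ℕ) * lineRestr x w f

/-- The matrix of the first `D₂ + 1` coefficients of the univariate family. [folklore] -/
def lmrFamilyMatrix (d D₁ D₂ : ℕ) (x w : ι → A) (U V : Matrix (Fin r) ι A) (f : MvPolynomial ι A) :
    Matrix (Option (Fin (D₁ + 1))) (Fin (D₂ + 1)) A :=
  Matrix.of fun a c => (lmrFamily d D₁ x w U V f a).coeff c

/-- The invariant: the determinant of the coefficient matrix of the univariate family paired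
with a test matrix `L`. It vanishes whenever the family is linearly dependent. [folklore] -/
def lmrInvariant (d D₁ D₂ : ℕ) (x w : ι → A) (U V : Matrix (Fin r) ι A)
    (L : Matrix (Option (Fin (D₁ + 1))) (Fin (D₂ + 1)) A) (f : MvPolynomial ι A) : A :=
  (lmrFamilyMatrix d D₁ D₂ x w U V f * Lᵀ).det

variable {B : Type*} [CommRing B]

/-- The univariate family commutes with base change. [folklore] -/
theorem lmrFamily_map (φ : A →+* B) (d D₁ : ℕ) (x w : ι → A) (U V : Matrix (Fin r) ι A)
    (f : MvPolynomial ι A) (a : Option (Fin (D₁ + 1))) :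
    (lmrFamily d D₁ x w U V f a).map φ =
      lmrFamily d D₁ (φ ∘ x) (φ ∘ w) (U.map φ) (V.map φ) (MvPolynomial.map φ f) a := by
  cases a with
  | none => simp [lmrFamily, Polynomial.map_pow, map_lineRestr, map_hessGenMinor]
  | some j => simp [lmrFamily, Polynomial.map_mul, Polynomial.map_pow, map_lineRestr]

/-- The coefficient matrix of the family commutes with base change. [folklore] -/
theorem lmrFamilyMatrix_map (φ : A →+* B) (d D₁ D₂ : ℕ) (x w : ι → A) (U V : Matrix (Fin r) ι A)
    (f : MvPolynomial ι A) :
    (lmrFamilyMatrix d D₁ D₂ x w U V f).map φ =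
      lmrFamilyMatrix d D₁ D₂ (φ ∘ x) (φ ∘ w) (U.map φ) (V.map φ) (MvPolynomial.map φ f) := by
  ext a c
  simp [lmrFamilyMatrix, ← lmrFamily_map, Polynomial.coeff_map]

/-- The invariant commutes with base change (it is a polynomial construction). [folklore] -/
theorem map_lmrInvariant (φ : A →+* B) (d D₁ D₂ : ℕ) (x w : ι → A) (U V : Matrix (Fin r) ι A)
    (L : Matrix (Option (Fin (D₁ + 1))) (Fin (D₂ + 1)) A) (f : MvPolynomial ι A) :
    φ (lmrInvariant d D₁ D₂ x w U V L f) =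
      lmrInvariant d D₁ D₂ (φ ∘ x) (φ ∘ w) (U.map φ) (V.map φ) (L.map φ)
        (MvPolynomial.map φ f) := by
  rw [lmrInvariant, RingHom.map_det, RingHom.mapMatrix_apply, Matrix.map_mul, lmrFamilyMatrix_map,
    Matrix.transpose_map]
  rfl

end Family

/-! ### The generic form and the transfer to orbit closures -/

section Transfer

variable {k : Type*} [Field k] {ι : Type*} [Fintype ι] [DecidableEq ι]

/-- The generic form of degree `d`: `∑_{|m| = d} Y_m X^m`, a polynomial in `X` whose coefficients
are the coordinate functions `Y_m` on the space of degree-`d` forms. [folklore] -/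
def genericForm (ι k : Type*) [Field k] [Fintype ι] [DecidableEq ι] (d : ℕ) :
    MvPolynomial ι (MvPolynomial (ι →₀ ℕ) k) :=
  ∑ m ∈ (Finset.univ : Finset ι).finsuppAntidiag d, monomial m (X m)

/-- Specialising the coefficient variables of the generic form to the coefficients of a form
`h` of degree `d` gives back `h`. [folklore] -/
theorem map_eval_coeffVec_genericForm {h : MvPolynomial ι k} {d : ℕ} (hh : h.IsHomogeneous d) :
    MvPolynomial.map (MvPolynomial.eval (coeffVec h)) (genericForm ι k d) = h := by
  classical
  rw [genericForm, map_sum]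
  simp only [map_monomial, eval_X, coeffVec_apply]
  conv_rhs => rw [h.as_sum]
  symm
  apply Finset.sum_subset
  · intro m hm
    rw [Finset.mem_finsuppAntidiag]
    refine ⟨?_, Finset.subset_univ _⟩
    rw [← Finsupp.degree_eq_sum]
    by_contra hne
    exact (mem_support_iff.mp hm) (hh.coeff_eq_zero hne)
  · intro m _ hm
    rw [notMem_support_iff.mp hm, monomial_zero]

/-- **Transfer principle.** A scalar-valued construction `Φ` on forms which is the
specialisation of a polynomial construction `Ψ` on the generic form (i.e. `Φ` is a polynomial in
the coefficients on degree-`d` forms) and which vanishes on the orbit `GL · f` of a degree-`d`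
form `f` vanishes on the orbit closure `Δ[f]`. Mulmuley–Sohoni 2001 §4. [folklore] -/
theorem transfer_orbitClosure {f g : MvPolynomial ι k} {d : ℕ} (hf : f.IsHomogeneous d)
    (hg : g ∈ orbitClosure f)
    (Ψ : MvPolynomial ι (MvPolynomial (ι →₀ ℕ) k) → MvPolynomial (ι →₀ ℕ) k)
    (Φ : MvPolynomial ι k → k)
    (hcomp : ∀ v : (ι →₀ ℕ) → k,
      MvPolynomial.eval v (Ψ (genericForm ι k d)) =
        Φ (MvPolynomial.map (MvPolynomial.eval v) (genericForm ι k d)))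
    (h0 : ∀ h ∈ glOrbit ι k f, Φ h = 0) : Φ g = 0 := by
  have hval : ∀ h : MvPolynomial ι k, h.IsHomogeneous d →
      aeval (coeffVec h) (Ψ (genericForm ι k d)) = Φ h := by
    intro h hh
    rw [show aeval (coeffVec h) (Ψ (genericForm ι k d)) =
        MvPolynomial.eval (coeffVec h) (Ψ (genericForm ι k d)) from rfl, hcomp,
      map_eval_coeffVec_genericForm hh]
  have hgd : g.IsHomogeneous d := hf.of_mem_orbitClosure hg
  rw [← hval g hgd]
  refine (mem_orbitClosure_iff.mp hg) _ fun h hh => ?_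
  have hhd : h.IsHomogeneous d := by
    obtain ⟨B, rfl⟩ := hh
    exact linSubst_isHomogeneous _ hf
  rw [hval h hhd]
  exact h0 h hh

/-- The invariant `lmrInvariant` is a polynomial in the coefficients, hence passes from the
orbit to the orbit closure. [folklore] -/
theorem lmrInvariant_eq_zero_of_mem_orbitClosure {f g : MvPolynomial ι k} {d : ℕ}
    (hf : f.IsHomogeneous d) (hg : g ∈ orbitClosure f) {r : ℕ} (D₁ D₂ : ℕ) (x w : ι → k)
    (U V : Matrix (Fin r) ι k) (L : Matrix (Option (Fin (D₁ + 1))) (Fin (D₂ + 1)) k)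
    (h0 : ∀ h ∈ glOrbit ι k f, lmrInvariant d D₁ D₂ x w U V L h = 0) :
    lmrInvariant d D₁ D₂ x w U V L g = 0 := by
  let C' : k →+* MvPolynomial (ι →₀ ℕ) k := MvPolynomial.C
  refine transfer_orbitClosure hf hg
    (fun F => lmrInvariant d D₁ D₂ (C' ∘ x) (C' ∘ w) (U.map C') (V.map C') (L.map C') F)
    (fun h => lmrInvariant d D₁ D₂ x w U V L h) (fun v => ?_) h0
  rw [map_lmrInvariant]
  have hx : ⇑(MvPolynomial.eval v) ∘ (C' ∘ x) = x := by funext i; simp [C']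
  have hw : ⇑(MvPolynomial.eval v) ∘ (C' ∘ w) = w := by funext i; simp [C']
  have hU : (U.map C').map (MvPolynomial.eval v) = U := Matrix.ext fun a b => by simp [C']
  have hV : (V.map C').map (MvPolynomial.eval v) = V := Matrix.ext fun a b => by simp [C']
  have hL : (L.map C').map (MvPolynomial.eval v) = L := Matrix.ext fun a b => by simp [C']
  rw [hx, hw, hU, hV, hL]

end Transfer


/-! ### Univariate divisibility: every root of `p` is a root of `q` forces `p ∣ q ^ d` -/

section Univariate

/-- Over an algebraically closed field: if `p ≠ 0` has degree `≤ d` and every root of `p` is a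
root of `q`, then `p ∣ q ^ d` (each root of `p` has multiplicity `≤ d`). [folklore] -/
theorem dvd_pow_of_roots {K : Type*} [Field K] [IsAlgClosed K] {p q : Polynomial K} {d : ℕ}
    (hp0 : p ≠ 0) (hdeg : p.natDegree ≤ d)
    (hroots : ∀ t, p.eval t = 0 → q.eval t = 0) : p ∣ q ^ d := by
  classical
  obtain rfl | hd := Nat.eq_zero_or_pos d
  · rw [pow_zero]
    rw [Polynomial.eq_C_of_natDegree_le_zero hdeg] at hp0 ⊢
    refine (Polynomial.isUnit_C.mpr ?_).dvd
    exact isUnit_iff_ne_zero.mpr fun h => hp0 (by rw [h, map_zero])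
  by_cases hq : q = 0
  · rw [hq, zero_pow hd.ne']
    exact dvd_zero p
  rw [(IsAlgClosed.splits p).eq_prod_roots,
    Polynomial.C_mul_dvd (Polynomial.leadingCoeff_ne_zero.mpr hp0),
    Multiset.prod_X_sub_C_dvd_iff_le_roots (pow_ne_zero d hq), Polynomial.roots_pow,
    Multiset.le_iff_count]
  intro a
  rw [Multiset.count_nsmul]
  by_cases ha : a ∈ p.roots
  · have hqa : a ∈ q.roots := by
      rw [Polynomial.mem_roots hq]
      exact hroots a ((Polynomial.mem_roots hp0).mp ha)
    have h1 : 1 ≤ Multiset.count a q.roots := Multiset.one_le_count_iff_mem.mpr hqa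
    calc Multiset.count a p.roots ≤ Multiset.card p.roots := Multiset.count_le_card _ _
      _ ≤ p.natDegree := Polynomial.card_roots' p
      _ ≤ d := hdeg
      _ ≤ d * Multiset.count a q.roots := Nat.le_mul_of_pos_right d h1
  · rw [Multiset.count_eq_zero_of_notMem ha]
    exact Nat.zero_le _

end Univariate

/-! ### Vanishing of the invariant from a linear dependence of the family -/

section Dependence

variable {K : Type*} [Field K] {ι : Type*} [Fintype ι] {r : ℕ}

/-- If a member of the univariate family vanishes, the invariant vanishes (a zero row).
[folklore] -/
theorem lmrInvariant_eq_zero_of_lmrFamily_eq_zero {d D₁ D₂ : ℕ} (x w : ι → K)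
    (U V : Matrix (Fin r) ι K) (L : Matrix (Option (Fin (D₁ + 1))) (Fin (D₂ + 1)) K)
    (f : MvPolynomial ι K) (a : Option (Fin (D₁ + 1))) (ha : lmrFamily d D₁ x w U V f a = 0) :
    lmrInvariant d D₁ D₂ x w U V L f = 0 := by
  unfold lmrInvariant
  refine Matrix.det_eq_zero_of_row_eq_zero a fun b => ?_
  simp [Matrix.mul_apply, lmrFamilyMatrix, ha]

/-- If `(det (U · Hess f · Vᵀ)|_L) ^ d = s · f|_L` with `deg s ≤ D₁`, the univariate family is
linearly dependent and the invariant vanishes. [folklore] -/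
theorem lmrInvariant_eq_zero_of_eq_mul {d D₁ D₂ : ℕ} (x w : ι → K)
    (U V : Matrix (Fin r) ι K) (L : Matrix (Option (Fin (D₁ + 1))) (Fin (D₂ + 1)) K)
    (f : MvPolynomial ι K) (s : Polynomial K) (hs : s.natDegree ≤ D₁)
    (hrel : lineRestr x w (hessGenMinor U V f) ^ d = s * lineRestr x w f) :
    lmrInvariant d D₁ D₂ x w U V L f = 0 := by
  classical
  set κ : Option (Fin (D₁ + 1)) → K := fun a => a.elim 1 fun j => -s.coeff j with hκ
  have hs' : s = ∑ j : Fin (D₁ + 1), Polynomial.C (s.coeff j) * Polynomial.X ^ (j : ℕ) := by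
    conv_lhs => rw [s.as_sum_range' (D₁ + 1) (Nat.lt_succ_of_le hs)]
    rw [Fin.sum_univ_eq_sum_range (fun j => Polynomial.C (s.coeff j) * Polynomial.X ^ j)
      (D₁ + 1)]
    simp only [Polynomial.C_mul_X_pow_eq_monomial]
  have hP : ∑ a, κ a • lmrFamily d D₁ x w U V f a = 0 := by
    rw [Fintype.sum_option]
    simp only [hκ, Option.elim, lmrFamily, one_smul, neg_smul, Finset.sum_neg_distrib]
    rw [hrel]
    have : ∑ j : Fin (D₁ + 1), s.coeff j • (Polynomial.X ^ (j : ℕ) * lineRestr x w f) =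
        s * lineRestr x w f := by
      conv_rhs => rw [hs']
      rw [Finset.sum_mul]
      refine Finset.sum_congr rfl fun j _ => ?_
      rw [Polynomial.smul_eq_C_mul, mul_assoc]
    rw [this, add_neg_cancel]
  have hκv : κ ᵥ* lmrFamilyMatrix d D₁ D₂ x w U V f = 0 := by
    funext c
    have := congrArg (fun P : Polynomial K => P.coeff (c : ℕ)) hP
    simpa only [Polynomial.finsetSum_coeff, Polynomial.coeff_smul, Polynomial.coeff_zero,
      smul_eq_mul, Matrix.vecMul, dotProduct, lmrFamilyMatrix, Matrix.of_apply, Pi.zero_apply] using this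
  have hκ0 : κ ≠ 0 := fun h => one_ne_zero (congrFun h none)
  unfold lmrInvariant
  by_contra hdet
  refine hκ0 (Matrix.eq_zero_of_vecMul_eq_zero hdet ?_)
  rw [← Matrix.vecMul_vecMul, hκv, Matrix.zero_vecMul]

/-- A square matrix of the form `U · H · Vᵀ` of size `N + 1` is singular when `rank H ≤ N`.
[folklore] -/
theorem det_mul_mul_transpose_eq_zero_of_rank_le {N : ℕ} {H : Matrix ι ι K} (hH : H.rank ≤ N)
    (U V : Matrix (Fin (N + 1)) ι K) : (U * H * Vᵀ).det = 0 := by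
  by_contra hdet
  have hU : IsUnit (U * H * Vᵀ) :=
    (Matrix.isUnit_iff_isUnit_det _).mpr (isUnit_iff_ne_zero.mpr hdet)
  have h1 := Matrix.rank_of_isUnit _ hU
  have h2 : (U * H * Vᵀ).rank ≤ N :=
    (Matrix.rank_mul_le_left _ _).trans ((Matrix.rank_mul_le_right _ _).trans hH)
  rw [h1, Fintype.card_fin] at h2
  omega

end Dependence

/-! ### The orbit side: the invariant vanishes on `GL · det_n` -/

section OrbitSide

variable {K : Type*} [Field K]

/-- Every element of `GL · det_n` is the determinant of a matrix of linear forms (an affine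
determinantal representation of size `n`) and is a form of degree `n`. [folklore] -/
theorem isAffineDetRepr_linSubst_detPoly {n : ℕ} (G : Matrix (Fin n × Fin n) (Fin n × Fin n) K) :
    IsAffineDetRepr (linSubst (Fin n × Fin n) K G (detPoly (Fin n) K))
      ((Matrix.mvPolynomialX (Fin n) (Fin n) K).map (linSubst (Fin n × Fin n) K G)) := by
  refine ⟨fun i j => ?_, ?_⟩
  · rw [Matrix.map_apply, Matrix.mvPolynomialX_apply, linSubst_X]
    exact totalDegree_finsetSum_le fun l _ =>
      (totalDegree_smul_le _ _).trans (totalDegree_X (R := K) l).le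
  · rw [detPoly, AlgHom.map_det]
    rfl

/-- **Orbit side** (Landsberg–Manivel–Ressayre 2013, §2.1 and §3.1: the dual of the determinant
hypersurface is the Segre variety, of dimension `2n - 2`, so `det_n ∈ Dual_{2n-2,n,n²}`; here in
the elementary form: at every zero of an element `h` of `GL · det_n` the Hessian has rank `≤ 2n`
(Mignon–Ressayre), hence on every line every root of `h|_L` is a root of every generalised
`(2n+1)`-minor, so `h|_L` divides its `n`-th power and the invariant vanishes).
[cite: LandsbergManivelRessayre2013, §2.1] -/
theorem lmrInvariant_eq_zero_of_mem_glOrbit_detPoly [IsAlgClosed K] {n : ℕ}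
    {h : MvPolynomial (Fin n × Fin n) K}
    (hh : h ∈ glOrbit (Fin n × Fin n) K (detPoly (Fin n) K)) (D₂ : ℕ)
    (x w : Fin n × Fin n → K) (U V : Matrix (Fin (2 * n + 1)) (Fin n × Fin n) K)
    (L : Matrix (Option (Fin (n * ((2 * n + 1) * n) + 1))) (Fin (D₂ + 1)) K) :
    lmrInvariant n (n * ((2 * n + 1) * n)) D₂ x w U V L h = 0 := by
  classical
  obtain ⟨G, rfl⟩ := hh
  set G' : Matrix (Fin n × Fin n) (Fin n × Fin n) K := (G : Matrix (Fin n × Fin n) (Fin n × Fin n) K)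
    with hG'
  have hA := isAffineDetRepr_linSubst_detPoly (K := K) G'
  have hhom : (linSubst (Fin n × Fin n) K G' (detPoly (Fin n) K)).IsHomogeneous n := by
    simpa using linSubst_isHomogeneous G' (detPoly_isHomogeneous (n := Fin n) (k := K))
  simp only [linSubstRep_apply]
  rw [← hG']
  set h := linSubst (Fin n × Fin n) K G' (detPoly (Fin n) K) with hh_def
  set p := lineRestr x w h with hp_def
  set q := lineRestr x w (hessGenMinor U V h) with hq_def
  by_cases hp : p = 0
  · refine lmrInvariant_eq_zero_of_lmrFamily_eq_zero x w U V L h (some 0) ?_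
    simp [lmrFamily, ← hp_def, hp]
  have hroots : ∀ t, p.eval t = 0 → q.eval t = 0 := by
    intro t ht
    rw [hp_def, eval_lineRestr] at ht
    rw [hq_def, eval_lineRestr, eval_hessGenMinor]
    have hrank := rank_hessianMatrix_le_two_mul_of_isAffineDetRepr hA (x + t • w) ht
    rw [Fintype.card_fin] at hrank
    exact det_mul_mul_transpose_eq_zero_of_rank_le hrank U V
  have hdeg : p.natDegree ≤ n := (natDegree_lineRestr_le x w h).trans hhom.totalDegree_le
  obtain ⟨s, hs⟩ := dvd_pow_of_roots hp hdeg hroots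
  by_cases hs0 : s = 0
  · refine lmrInvariant_eq_zero_of_lmrFamily_eq_zero x w U V L h none ?_
    simp only [lmrFamily, ← hq_def, hs, hs0, mul_zero]
  have hsdeg : s.natDegree ≤ n * ((2 * n + 1) * n) := by
    have h1 : (p * s).natDegree = p.natDegree + s.natDegree := Polynomial.natDegree_mul hp hs0
    have h2 : (q ^ n).natDegree ≤ n * q.natDegree := Polynomial.natDegree_pow_le
    have h3 : q.natDegree ≤ (2 * n + 1) * n :=
      (natDegree_lineRestr_le _ _ _).trans ((totalDegree_hessGenMinor_le U V h).trans
        (Nat.mul_le_mul_left _ hhom.totalDegree_le))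
    rw [hs, h1] at h2
    calc s.natDegree ≤ p.natDegree + s.natDegree := Nat.le_add_left _ _
      _ ≤ n * q.natDegree := h2
      _ ≤ n * ((2 * n + 1) * n) := Nat.mul_le_mul_left n h3
  exact lmrInvariant_eq_zero_of_eq_mul x w U V L h s hsdeg (by rw [← hq_def, hs, mul_comm])

end OrbitSide


/-! ### Independence of the family gives a test matrix with invariant `1` -/

section Independence

variable {K : Type*} [Field K] {ι : Type*} [Fintype ι] {r : ℕ}

/-- If the univariate family (with degrees `≤ D₂`) is linearly independent, some test matrix `L`
makes the invariant equal to `1`: the rows of the coefficient matrix are independent, so the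
row-combination map has a linear left inverse. [folklore] -/
theorem exists_lmrInvariant_eq_one {d D₁ D₂ : ℕ} (x w : ι → K) (U V : Matrix (Fin r) ι K)
    (f : MvPolynomial ι K)
    (hdeg : ∀ a, (lmrFamily d D₁ x w U V f a).natDegree ≤ D₂)
    (hind : ∀ κ : Option (Fin (D₁ + 1)) → K,
      ∑ a, κ a • lmrFamily d D₁ x w U V f a = 0 → κ = 0) :
    ∃ L : Matrix (Option (Fin (D₁ + 1))) (Fin (D₂ + 1)) K,
      lmrInvariant d D₁ D₂ x w U V L f = 1 := by
  classical
  set FM := lmrFamilyMatrix d D₁ D₂ x w U V f with hFM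
  have hker : LinearMap.ker (Matrix.vecMulLinear FM) = ⊥ := by
    rw [LinearMap.ker_eq_bot']
    intro κ hκ
    rw [Matrix.vecMulLinear_apply] at hκ
    apply hind
    apply Polynomial.ext
    intro c
    rw [Polynomial.finsetSum_coeff, Polynomial.coeff_zero]
    simp only [Polynomial.coeff_smul, smul_eq_mul]
    by_cases hc : c < D₂ + 1
    · have := congrFun hκ ⟨c, hc⟩
      simpa [Matrix.vecMul, dotProduct, hFM, lmrFamilyMatrix] using this
    · refine Finset.sum_eq_zero fun a _ => ?_
      rw [Polynomial.coeff_eq_zero_of_natDegree_lt ((hdeg a).trans_lt (by omega)), mul_zero]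
  refine ⟨LinearMap.toMatrix' (Matrix.vecMulLinear FM).leftInverse, ?_⟩
  unfold lmrInvariant
  rw [← hFM]
  suffices h1 : FM * (LinearMap.toMatrix' (Matrix.vecMulLinear FM).leftInverse)ᵀ = 1 by
    rw [h1, Matrix.det_one]
  ext a b
  have hrow := LinearMap.leftInverse_apply_of_inj hker (Pi.single a 1)
  rw [Matrix.vecMulLinear_apply, Matrix.single_one_vecMul] at hrow
  have : (FM * (LinearMap.toMatrix' (Matrix.vecMulLinear FM).leftInverse)ᵀ) a b =
      (LinearMap.toMatrix' (Matrix.vecMulLinear FM).leftInverse *ᵥ FM.row a) b := by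
    simp [Matrix.mul_apply, Matrix.mulVec, dotProduct, mul_comm]
  rw [this, LinearMap.toMatrix'_mulVec, hrow, Matrix.one_apply, Pi.single_apply]
  simp only [eq_comm]

end Independence

/-! ### The permanent side: the invariant does not vanish at the padded permanent -/

section PermanentSide

variable {K : Type*} [Field K]

/-- A product of entries, along a partial permutation, of the all-ones matrix with `(0,0)` entry
`a`: it is `a` if the product passes through `(0,0)` and `1` otherwise. [folklore] -/
theorem prod_onesExcept {m : ℕ} (a : K) (S : Finset (Fin (m + 3))) (π : Equiv.Perm (Fin (m + 3))) :
    ∏ i ∈ S, (fun u : Fin (m + 3) × Fin (m + 3) => if u.1 = 0 ∧ u.2 = 0 then a else 1) (π i, i) =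
      if 0 ∈ S ∧ π 0 = 0 then a else 1 := by
  by_cases h : 0 ∈ S ∧ π 0 = 0
  · rw [if_pos h, Finset.prod_eq_single_of_mem (0 : Fin (m + 3)) h.1]
    · simp [h.2]
    · intro i _ hi
      simp [hi]
  · rw [if_neg h]
    refine Finset.prod_eq_one fun i hi => ?_
    dsimp only
    rw [if_neg]
    rintro ⟨h1, h2⟩
    subst h2
    exact h ⟨hi, h1⟩

/-- The permanent of the all-ones matrix with `(0,0)` entry `a` is `(a + m + 2) · (m+2)!`
(size `m + 3`); for `a = -(m+2)` this is the Mignon–Ressayre zero `per(y₀) = 0`.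
[folklore] -/
theorem eval_onesExcept_perPoly {m : ℕ} (a : K) :
    eval (fun u : Fin (m + 3) × Fin (m + 3) => if u.1 = 0 ∧ u.2 = 0 then a else 1)
      (perPoly (Fin (m + 3)) K) = (a + (m + 2)) * (m + 2).factorial := by
  classical
  rw [eval_perPoly]
  simp only [Matrix.permanent, Matrix.of_apply]
  simp_rw [prod_onesExcept, Finset.mem_univ, true_and]
  rw [Finset.sum_ite, Finset.sum_const, Finset.sum_const]
  have hA : (Finset.univ.filter fun π : Equiv.Perm (Fin (m + 3)) => π 0 = 0).card
      = (m + 2).factorial := by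
    rw [← Fintype.card_subtype, card_perm_apply_eq_one, Fintype.card_fin]
    rfl
  have hAB := Finset.card_filter_add_card_filter_not
    (s := (Finset.univ : Finset (Equiv.Perm (Fin (m + 3))))) (fun π => π 0 = 0)
  rw [Finset.card_univ, Fintype.card_perm, Fintype.card_fin, hA, Nat.factorial_succ (m + 2)] at hAB
  have hB : (Finset.univ.filter fun π : Equiv.Perm (Fin (m + 3)) => ¬ π 0 = 0).card
      = (m + 2) * (m + 2).factorial := by
    have := (m + 2).factorial_pos
    nlinarith [hAB]
  rw [hA, hB]
  simp only [nsmul_eq_mul]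
  push_cast
  ring


/-- **Permanent side** (Landsberg–Manivel–Ressayre 2013, Lemma 2.4.1 with [3] = Mignon–Ressayre:
the dual of `Z(ℓ^{n-m} perm_m)` has dimension `m² - 2`, i.e. the Hessian of the padded permanent
has rank `≥ m²` at some point of its zero set). Elementary form: at the point `x₀` (Mignon–Ressayre
point on the block, `1` elsewhere) and in the direction `w₀` of the `(0,0)` block entry, the padded
permanent restricted to the line is `(m+2)! · t ≠ 0` with a root at `t = 0`, while a suitable
generalised `(2n+1)`-minor of its Hessian equals `1` at `x₀` (the block of the Hessian is
`m! · mrHess`, invertible); so the univariate family is linearly independent and some test matrix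
gives invariant `1`. Requires `2n + 1 ≤ m²`. [cite: LandsbergManivelRessayre2013, Lemma 2.4.1] -/
theorem exists_lmrInvariant_eq_one_paddedPerPoly [CharZero K] {m n : ℕ} [NeZero n]
    (hmn : m + 3 ≤ n) (hr : 2 * n + 1 ≤ (m + 3) * (m + 3)) :
    ∃ (x w : Fin n × Fin n → K) (U V : Matrix (Fin (2 * n + 1)) (Fin n × Fin n) K)
      (L : Matrix (Option (Fin (n * ((2 * n + 1) * n) + 1)))
        (Fin (n * ((2 * n + 1) * n) + n + 1)) K),
      lmrInvariant n (n * ((2 * n + 1) * n)) (n * ((2 * n + 1) * n) + n) x w U V L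
        (paddedPerPoly K (m + 3) n) = 1 := by
  classical
  -- block placement `θ` of the `(m+3) × (m+3)` permanent inside the `n × n` matrix
  set e : Fin (m + 3) ≃ BlockIdx (m + 3) n :=
    (Fintype.equivFinOfCardEq (card_blockIdx hmn)).symm with he
  set θ : Fin (m + 3) × Fin (m + 3) → Fin n × Fin n :=
    fun ij => ((e ij.1 : Fin n), (e ij.2 : Fin n)) with hθ
  have hθinj : Function.Injective θ := by
    intro a b hab
    simp only [hθ, Prod.mk.injEq] at hab
    exact Prod.ext (e.injective (Subtype.val_injective hab.1))
      (e.injective (Subtype.val_injective hab.2))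
  set g := paddedPerPoly K (m + 3) n with hg_def
  have hg : g = X (0, 0) ^ (n - (m + 3)) * rename θ (perPoly (Fin (m + 3)) K) := by
    rw [hg_def, paddedPerPoly, ← rename_perPoly_equiv e, rename_rename]
    rfl
  have hhom : g.IsHomogeneous n := paddedPerPoly_isHomogeneous hmn
  -- the padding variable is not a block variable (when there is padding at all)
  have hθ0 : 0 < n - (m + 3) → ∀ u, θ u ≠ (0, 0) := by
    intro hpos u h
    have h1 : ((e u.1 : Fin n) : ℕ) = 0 := by
      have := congrArg Prod.fst h
      simp only [hθ] at this
      rw [this]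
      rfl
    have h2 := (e u.1).2
    omega
  have hpad : ∀ v, pderiv (θ v) (X (0, 0) ^ (n - (m + 3)) : MvPolynomial (Fin n × Fin n) K) = 0 := by
    intro v
    rcases Nat.eq_zero_or_pos (n - (m + 3)) with h0 | hpos
    · rw [h0, pow_zero, pderiv_one]
    · rw [pderiv_pow, pderiv_X_of_ne (hθ0 hpos v).symm, mul_zero]
  -- the point and the direction
  set x₀ : Fin n × Fin n → K := Function.extend θ (mrPoint K m) (fun _ => 1) with hx₀
  set w₀ : Fin n × Fin n → K := Pi.single (θ (0, 0)) 1 with hw₀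
  have hx₀θ : ∀ u, x₀ (θ u) = mrPoint K m u := fun u => hθinj.extend_apply _ _ u
  have hpadval : ∀ t : K,
      eval (x₀ + t • w₀) (X (0, 0) ^ (n - (m + 3)) : MvPolynomial (Fin n × Fin n) K) = 1 := by
    intro t
    rcases Nat.eq_zero_or_pos (n - (m + 3)) with h0 | hpos
    · rw [h0, pow_zero, map_one]
    · have hnot : ¬ ∃ u, θ u = (0, 0) := fun ⟨u, hu⟩ => hθ0 hpos u hu
      have hw00 : w₀ (0, 0) = 0 := by
        rw [hw₀, Pi.single_eq_of_ne]
        exact fun h => hθ0 hpos (0, 0) h.symm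
      rw [map_pow, eval_X, Pi.add_apply, Pi.smul_apply, hw00, smul_zero, add_zero, hx₀,
        Function.extend_apply' _ _ _ hnot, one_pow]
  have hline : ∀ t : K, (x₀ + t • w₀) ∘ θ =
      fun u => if u.1 = 0 ∧ u.2 = 0 then -((m : K) + 2) + t else 1 := by
    intro t
    funext u
    simp only [Function.comp_apply, Pi.add_apply, Pi.smul_apply, smul_eq_mul]
    rw [hx₀θ u, hw₀, mrPoint_apply]
    by_cases hu : u.1 = 0 ∧ u.2 = 0
    · have : u = (0, 0) := Prod.ext hu.1 hu.2
      subst this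
      simp
    · have : u ≠ (0, 0) := fun h => hu ⟨by rw [h], by rw [h]⟩
      simp [hu, hθinj.eq_iff, this]
  -- values of `g` on the line: `(m+2)! · t`
  have hgval : ∀ t : K, eval (x₀ + t • w₀) g = t * (m + 2).factorial := by
    intro t
    rw [hg, map_mul, hpadval, one_mul, eval_rename, hline t, eval_onesExcept_perPoly]
    ring
  -- the block of the Hessian at `x₀` is `m! · mrHess`
  set S : Matrix (Fin (m + 3) × Fin (m + 3)) (Fin (m + 3) × Fin (m + 3)) K :=
    (m.factorial : K) • mrHess K m with hS
  have hHess : ∀ u v : Fin (m + 3) × Fin (m + 3), hessianMatrix g x₀ (θ u) (θ v) = S u v := by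
    intro u v
    rw [hessianMatrix_apply, hg, pderiv_mul, hpad, zero_mul, zero_add, pderiv_mul, hpad, zero_mul,
      zero_add, map_mul, pderiv_rename hθinj, pderiv_rename hθinj, eval_rename]
    have h1 : eval x₀ (X (0, 0) ^ (n - (m + 3)) : MvPolynomial (Fin n × Fin n) K) = 1 := by
      simpa using hpadval 0
    have h2 : x₀ ∘ θ = mrPoint K m := funext hx₀θ
    rw [h1, one_mul, h2, ← hess0_transl, hess0_transl_mrPoint_perPoly, hS]
  have hSunit : IsUnit S.det := by
    rw [← Matrix.isUnit_iff_isUnit_det]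
    apply Matrix.mulVec_injective_iff_isUnit.mp
    intro v₁ v₂ hv
    rw [hS, Matrix.smul_mulVec, Matrix.smul_mulVec] at hv
    exact mrHess_mulVec_injective
      (smul_right_injective _ (Nat.cast_ne_zero.mpr (Nat.factorial_ne_zero m)) hv)
  -- selection of `2n + 1` block coordinates and the matrices `U = P S⁻¹ E`, `V = P E`
  set c : Fin (2 * n + 1) → Fin (m + 3) × Fin (m + 3) :=
    fun a => finProdFinEquiv.symm (Fin.castLE hr a) with hc
  have hcinj : Function.Injective c := fun a b hab =>
    Fin.castLE_injective hr (finProdFinEquiv.symm.injective hab)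
  set E : Matrix (Fin (m + 3) × Fin (m + 3)) (Fin n × Fin n) K :=
    fun b i => if i = θ b then 1 else 0 with hE
  set P : Matrix (Fin (2 * n + 1)) (Fin (m + 3) × Fin (m + 3)) K :=
    fun a b => if b = c a then 1 else 0 with hP
  have hE1 : E * hessianMatrix g x₀ * Eᵀ = S := by
    ext b b'
    simp only [Matrix.mul_apply, Matrix.transpose_apply, hE, ite_mul, one_mul, zero_mul, mul_ite,
      mul_one, mul_zero, Finset.sum_ite_eq', Finset.mem_univ, if_true]
    exact hHess b b'
  have hE2 : P * Pᵀ = 1 := by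
    ext a a'
    simp only [Matrix.mul_apply, Matrix.transpose_apply, hP, Matrix.one_apply, mul_ite, mul_one,
      mul_zero, Finset.sum_ite_eq', Finset.mem_univ, if_true]
    by_cases h : a = a'
    · simp [h]
    · rw [if_neg (fun h' => h (hcinj h').symm), if_neg h]
  have hUHV : P * S⁻¹ * E * hessianMatrix g x₀ * (P * E)ᵀ = 1 := by
    rw [Matrix.transpose_mul]
    calc P * S⁻¹ * E * hessianMatrix g x₀ * (Eᵀ * Pᵀ)
        = P * (S⁻¹ * (E * hessianMatrix g x₀ * Eᵀ)) * Pᵀ := by simp only [Matrix.mul_assoc]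
      _ = 1 := by rw [hE1, Matrix.nonsing_inv_mul _ hSunit, Matrix.mul_one, hE2]
  -- degrees of the family
  have hdeg : ∀ a, (lmrFamily n (n * ((2 * n + 1) * n)) x₀ w₀ (P * S⁻¹ * E) (P * E) g a).natDegree
      ≤ n * ((2 * n + 1) * n) + n := by
    intro a
    cases a with
    | none =>
      simp only [lmrFamily]
      refine Polynomial.natDegree_pow_le.trans ?_
      refine (Nat.mul_le_mul_left n ((natDegree_lineRestr_le _ _ _).trans
        ((totalDegree_hessGenMinor_le _ _ _).trans (Nat.mul_le_mul_left _ hhom.totalDegree_le)))).trans ?_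
      exact Nat.le_add_right _ _
    | some j =>
      simp only [lmrFamily]
      refine Polynomial.natDegree_mul_le.trans ?_
      refine (add_le_add Polynomial.natDegree_pow_le
        ((natDegree_lineRestr_le _ _ _).trans hhom.totalDegree_le)).trans ?_
      rw [Polynomial.natDegree_X, mul_one]
      have := j.2
      omega
  -- independence of the family
  have hind : ∀ κ : Option (Fin (n * ((2 * n + 1) * n) + 1)) → K,
      ∑ a, κ a • lmrFamily n (n * ((2 * n + 1) * n)) x₀ w₀ (P * S⁻¹ * E) (P * E) g a = 0 → κ = 0 := by
    intro κ hκ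
    set p := lineRestr x₀ w₀ g with hp
    set q := lineRestr x₀ w₀ (hessGenMinor (P * S⁻¹ * E) (P * E) g) with hq
    have hp0 : p.eval 0 = 0 := by
      rw [hp, eval_lineRestr, hgval, zero_mul]
    have hp1 : p ≠ 0 := by
      intro h
      have := congrArg (Polynomial.eval 1) h
      rw [hp, eval_lineRestr, hgval, Polynomial.eval_zero, one_mul] at this
      exact Nat.cast_ne_zero.mpr (Nat.factorial_ne_zero (m + 2)) this
    have hq0 : q.eval 0 = 1 := by
      rw [hq, eval_lineRestr, eval_hessGenMinor, zero_smul, add_zero, hUHV, Matrix.det_one]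
    have hnone : κ none = 0 := by
      have := congrArg (Polynomial.eval 0) hκ
      rw [Polynomial.eval_finsetSum, Fintype.sum_option, Polynomial.eval_zero] at this
      simp only [lmrFamily, Polynomial.eval_smul, Polynomial.eval_pow, Polynomial.eval_mul,
        Polynomial.eval_X, smul_eq_mul] at this
      rw [← hq, ← hp, hq0, hp0] at this
      simpa using this
    have hrest : (∑ j : Fin (n * ((2 * n + 1) * n) + 1), κ (some j) • Polynomial.X ^ (j : ℕ)) * p
        = 0 := by
      rw [Fintype.sum_option, hnone, zero_smul, zero_add] at hκ
      rw [Finset.sum_mul]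
      simpa only [lmrFamily, smul_mul_assoc, ← hp] using hκ
    have hsum : ∑ j : Fin (n * ((2 * n + 1) * n) + 1), κ (some j) • Polynomial.X ^ (j : ℕ) =
        (0 : Polynomial K) :=
      (mul_eq_zero.mp hrest).resolve_right hp1
    funext a
    cases a with
    | none => exact hnone
    | some j =>
      have := congrArg (fun P : Polynomial K => P.coeff (j : ℕ)) hsum
      simp only [Polynomial.finsetSum_coeff, Polynomial.coeff_smul, Polynomial.coeff_X_pow,
        smul_eq_mul, mul_ite, mul_one, mul_zero, Polynomial.coeff_zero, Fin.val_inj,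
        Finset.sum_ite_eq, Finset.mem_univ, if_true] at this
      exact this
  obtain ⟨L, hL⟩ := exists_lmrInvariant_eq_one x₀ w₀ (P * S⁻¹ * E) (P * E) g hdeg hind
  exact ⟨x₀, w₀, P * S⁻¹ * E, P * E, L, hL⟩

end PermanentSide

/-! ### Assembly: Theorem 1.1.1 -/

section MainTheorem

/-- **Discharge of `LMR2013_thm_1_1_1`** (Landsberg–Manivel–Ressayre 2013, Theorem 1.1.1:
`\overline{dc}(perm_m) ≥ m²/2`). If `X₀₀^{n-m} per_m ∈ Δ[det_n]` with `m ≤ n` but `2n < m²`,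
then `m ≥ 3` and `2n + 1 ≤ m²`; the invariant `lmrInvariant` (a polynomial in the coefficients)
vanishes on `GL · det_n` (`lmrInvariant_eq_zero_of_mem_glOrbit_detPoly`), hence on `Δ[det_n]`
(`lmrInvariant_eq_zero_of_mem_orbitClosure`), but equals `1` at the padded permanent for a
suitable choice of line, minor and test matrix (`exists_lmrInvariant_eq_one_paddedPerPoly`).
[cite: LandsbergManivelRessayre2013, Theorem 1.1.1] -/
theorem LMR2013_thm_1_1_1_holds : LMR2013_thm_1_1_1 := by
  intro m n _ hmn hmem
  by_contra hlt
  rw [not_le, sq] at hlt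
  have hm3 : 3 ≤ m := by
    by_contra h
    rw [not_le] at h
    interval_cases m <;> omega
  obtain ⟨m', rfl⟩ : ∃ m', m = m' + 3 := ⟨m - 3, by omega⟩
  have hr : 2 * n + 1 ≤ (m' + 3) * (m' + 3) := by omega
  obtain ⟨x, w, U, V, L, hL⟩ := exists_lmrInvariant_eq_one_paddedPerPoly (K := ℂ) hmn hr
  have hdet : (detPoly (Fin n) ℂ).IsHomogeneous n := by
    simpa using detPoly_isHomogeneous (n := Fin n) (k := ℂ)
  have h0 := lmrInvariant_eq_zero_of_mem_orbitClosure hdet hmem (n * ((2 * n + 1) * n))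
    (n * ((2 * n + 1) * n) + n) x w U V L
    (fun h hh => lmrInvariant_eq_zero_of_mem_glOrbit_detPoly hh _ x w U V L)
  rw [hL] at h0
  exact one_ne_zero h0

end MainTheorem

end Literature.Computability.AlgebraicComplexity
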